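import Literature.NumberTheory.LFunctions.XiDerivativeCriticalLineProportionTwoThirds
import Literature.NumberTheory.LFunctions.MontgomeryTaylorConstantNumerics
import HarnessLib

/-!
# [AF26] Theorem A with the Montgomery–Taylor window, CUMULATIVE forms: `≥ (0.6725 − ε) N(T)` simple
# critical zeros, `≥ (0.83625 − ε) N(T)` distinct zeros, and `κ′₁ ≥ 2 − c_MT⁻¹ = 0.6725…` for `ξ′`

RH-FREE (every statement below is an unconditional theorem of this tree; «nothing here bears on the
truth of RH»). Topic `Literature/NumberTheory/LFunctions`, namespace `Literature.NumberTheory.LFunctions`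
(helpers in `AlpogeFurman2026.MTCumulative`). PROOF LAYER: theorems only — no definitions, no named facts.

[AF26] (Alpöge–Furman, arXiv:2608.13637v2, unrefereed preprint) Theorem A, second sentence, is typed in
`CriticalLineTwoThirds.lean` in DYADIC form — `AlpogeFurman2026_simple_critical_MT_dyadic`
(`N₀ˢ(T,2T) ≥ (2 − c_MT⁻¹ − ε) N(T,2T)`) and `AlpogeFurman2026_distinct_MT_dyadic`
(`N_d(T,2T) ≥ (½(3 − c_MT⁻¹) − ε) N(T,2T)`) — and both are kernel theorems of the tree (`…_holds`,
`CriticalLineTwoThirdsTheoremAProofs.lean`). The tree carried the cumulative form only with the flat-window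
constants `2/3`, `5/6` (`AlpogeFurman2026_simple_critical_holds`, `_distinct_holds`; the MT claims were fed
through `AlpogeFurman2026_simple_critical_of_MT`, losing the constant). Summing over dyadic windows
(the generic telescoping of `XiDerivativeZerosCounting.lean`: `XiDerivCount.telescope`,
`XiDerivCount.eventually_of_telescope`) gives the cumulative statements with the MT constants:

* `AlpogeFurman2026_simple_critical_MT_cumulative` — `∀ ε > 0`, eventually
  `(2 − c_MT⁻¹ − ε) N(T) ≤ N₀ˢ(T)`; numerically `(0.6725 − ε) N(T) ≤ N₀ˢ(T)`
  (`montgomeryTaylorInvConstant_bounds`: `c_MT⁻¹ < 1.3275`);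
* `AlpogeFurman2026_distinct_MT_cumulative` — `(½(3 − c_MT⁻¹) − ε) N(T) ≤ N_d(T)`; numerically
  `(0.83625 − ε) N(T) ≤ N_d(T)`;
* for `ξ′` (generic transfer `le_xiDerivCriticalLineProportion_one_of_simpleCritical`: any cumulative
  proportion `κ` of simple critical zeros of `ζ` is a lower bound for `κ′₁`, by Rolle —
  `XiDerivativeCriticalZerosRolle.lean` — and Conrey's Lemma 2 — `XiDerivativeZeroCountingFunction.lean`):
  **`two_sub_montgomeryTaylorInvConstant_le_xiDerivCriticalLineProportion_one : 2 − c_MT⁻¹ ≤ κ′₁`**, hence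
  `0.6725 ≤ κ′₁`, sharpening `two_thirds_le_xiDerivCriticalLineProportion_one`.

Status: still below the printed records (`κ′₁ ≥ 0.8137`, Conrey 1983, Levinson's method — the named fact
`conrey1983_xiDeriv_one`; [AF26] Remark 7.1 claims `0.85838`). [AF26]'s Theorem A enters only through the
kernel theorems `AlpogeFurman2026_simple_critical_MT_dyadic_holds` / `_distinct_MT_dyadic_holds` (standard
axioms); no endorsement of the preprint beyond those kernel facts. Nothing here bears on the truth of RH.

## References

* L. Alpöge, K. Furman, arXiv:2608.13637v2 (2026): Theorem A (p. 1), §6 (p. 12: "summing over dyadic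
  windows"), Remark 7.1. [key `AlpogeFurman2026`]
* J. B. Conrey, J. Number Theory 16 (1983) 49–74: §1 (p. 49), Lemma 2 (p. 52), Corollary (p. 50).
  [key `Conrey1983`]
-/

noncomputable section

open Filter Topology

namespace Literature.NumberTheory.LFunctions

namespace AlpogeFurman2026.MTCumulative

/-- **Dyadic ⇒ cumulative, any constant.** If a count `A : ℝ → ℕ` satisfies, for every `ε > 0`,
`(κ − ε)(N(2T) − N(T)) ≤ A(2T) − A(T)` for all large `T`, then for every `ε > 0`,
`(κ − ε) N(T) ≤ A(T)` for all large `T` (telescoping over the windows `(T₀ 2^j, T₀ 2^{j+1}]` and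
`N(T) → ∞`). [cite: AlpogeFurman2026, §6 proof of Theorem A (p. 12)] -/
theorem eventually_cumulative_of_dyadic {A : ℝ → ℕ} {κ : ℝ}
    (h : ∀ ε : ℝ, 0 < ε → ∀ᶠ T : ℝ in atTop,
      (κ - ε) * ((zetaZeroCount (2 * T) : ℝ) - zetaZeroCount T) ≤ (A (2 * T) : ℝ) - A T) :
    ∀ ε : ℝ, 0 < ε → ∀ᶠ T : ℝ in atTop, (κ - ε) * (zetaZeroCount T : ℝ) ≤ A T := by
  intro ε hε
  rcases le_or_gt (κ - ε) 0 with hneg | hpos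
  · exact Filter.Eventually.of_forall fun T ↦ by
      have h0 : (0 : ℝ) ≤ A T := Nat.cast_nonneg _
      have h1 : (0 : ℝ) ≤ zetaZeroCount T := Nat.cast_nonneg _
      nlinarith
  obtain ⟨T₀', hT₀'⟩ := Filter.eventually_atTop.1 (h (ε / 2) (by positivity))
  set T₀ : ℝ := max T₀' 1 with hT₀
  have hT₀pos : 0 < T₀ := lt_of_lt_of_le zero_lt_one (le_max_right _ _)
  have hc : 0 ≤ κ - ε / 2 := by linarith
  have htel := XiDerivCount.telescope (N := fun T ↦ (zetaZeroCount T : ℝ)) (A := fun T ↦ (A T : ℝ))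
    (fun a b hab ↦ by simpa using (Nat.cast_le (α := ℝ)).2 (zetaZeroCount_mono hab))
    (fun T ↦ Nat.cast_nonneg _) hc
    hT₀pos.le (fun T hT ↦ hT₀' T ((le_max_left _ _).trans hT))
  have hall : ∀ T : ℝ, T₀ ≤ T →
      (κ - ε / 2) * ((zetaZeroCount T : ℝ) - zetaZeroCount (2 * T₀)) ≤ A T := by
    intro T hT
    obtain ⟨n, hn⟩ := XiDerivCount.exists_le_two_pow_mul (T₀ := T₀) (T := T) hT₀pos
    exact htel n T hT hn
  have hlim : Tendsto (fun T : ℝ ↦ (zetaZeroCount T : ℝ)) atTop atTop :=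
    tendsto_natCast_atTop_atTop.comp tendsto_zetaZeroCount_atTop_holds
  have hev := XiDerivCount.eventually_of_telescope (N := fun T ↦ (zetaZeroCount T : ℝ))
    (A := fun T ↦ (A T : ℝ)) hlim hall (δ := ε / 2) (by positivity)
  refine hev.mono fun T hT ↦ ?_
  have hT' : (κ - ε / 2 - ε / 2) * (zetaZeroCount T : ℝ) ≤ A T := hT
  have e : κ - ε / 2 - ε / 2 = κ - ε := by ring
  rw [e] at hT'
  exact hT'

end AlpogeFurman2026.MTCumulative

open AlpogeFurman2026.MTCumulative

/-- **[AF26] Theorem A (i), Montgomery–Taylor window, cumulative**: for every `ε > 0` and all large `T`,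
`(2 − c_MT⁻¹ − ε) N(T) ≤ N₀ˢ(T)` — at least `(0.67250… − ε) N(T)` zeros of `ζ` with `0 < Im ρ ≤ T`
are simple and on the critical line (dyadic kernel theorem `AlpogeFurman2026_simple_critical_MT_dyadic_holds`
summed over dyadic windows). [cite: AlpogeFurman2026, Theorem A (p. 1) and §6 (p. 12)] -/
theorem AlpogeFurman2026_simple_critical_MT_cumulative (ε : ℝ) (hε : 0 < ε) :
    ∀ᶠ T : ℝ in atTop,
      (2 - montgomeryTaylorInvConstant - ε) * (zetaZeroCount T : ℝ) ≤ simpleCriticalZeroCount T :=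
  eventually_cumulative_of_dyadic (A := simpleCriticalZeroCount) (κ := 2 - montgomeryTaylorInvConstant)
    (fun δ hδ ↦ AlpogeFurman2026_simple_critical_MT_dyadic_holds δ hδ) ε hε

/-- Numerically: for every `ε > 0`, eventually `(0.6725 − ε) N(T) ≤ N₀ˢ(T)` (`c_MT⁻¹ < 1.3275`,
`montgomeryTaylorInvConstant_bounds`). [cite: AlpogeFurman2026, Theorem A (p. 1)] -/
theorem AlpogeFurman2026_simple_critical_MT_cumulative' (ε : ℝ) (hε : 0 < ε) :
    ∀ᶠ T : ℝ in atTop, (0.6725 - ε) * (zetaZeroCount T : ℝ) ≤ simpleCriticalZeroCount T := by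
  have hR := montgomeryTaylorInvConstant_bounds.2
  filter_upwards [AlpogeFurman2026_simple_critical_MT_cumulative ε hε] with T hT
  have hN : (0 : ℝ) ≤ zetaZeroCount T := Nat.cast_nonneg _
  nlinarith

/-- **[AF26] Theorem A (ii), Montgomery–Taylor window, cumulative**: for every `ε > 0` and all large
`T`, `(½(3 − c_MT⁻¹) − ε) N(T) ≤ N_d(T)` — at least `(0.83625… − ε) N(T)` distinct zeros.
[cite: AlpogeFurman2026, Theorem A (p. 1) and §6 (p. 12)] -/
theorem AlpogeFurman2026_distinct_MT_cumulative (ε : ℝ) (hε : 0 < ε) :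
    ∀ᶠ T : ℝ in atTop,
      ((3 - montgomeryTaylorInvConstant) / 2 - ε) * (zetaZeroCount T : ℝ) ≤ distinctZeroCount T :=
  eventually_cumulative_of_dyadic (A := distinctZeroCount) (κ := (3 - montgomeryTaylorInvConstant) / 2)
    (fun δ hδ ↦ AlpogeFurman2026_distinct_MT_dyadic_holds δ hδ) ε hε

/-- Numerically: for every `ε > 0`, eventually `(0.83625 − ε) N(T) ≤ N_d(T)`.
[cite: AlpogeFurman2026, Theorem A (p. 1)] -/
theorem AlpogeFurman2026_distinct_MT_cumulative' (ε : ℝ) (hε : 0 < ε) :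
    ∀ᶠ T : ℝ in atTop, (0.83625 - ε) * (zetaZeroCount T : ℝ) ≤ distinctZeroCount T := by
  have hR := montgomeryTaylorInvConstant_bounds.2
  filter_upwards [AlpogeFurman2026_distinct_MT_cumulative ε hε] with T hT
  have hN : (0 : ℝ) ≤ zetaZeroCount T := Nat.cast_nonneg _
  nlinarith

/-! ## Transfer to `ξ′` -/

/-- **From simple critical zeros of `ζ` to critical zeros of `ξ′`, any constant.** If for every `ε > 0`,
eventually `(κ − ε) N(T) ≤ N₀ˢ(T)`, then for every `ε > 0`, eventually `(κ − ε) N^{(1)}(T) ≤ N^{(1)}₀(T)`: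
Rolle (`N₀ˢ ≤ N^{(1)}₀ + 1`, `simpleCriticalZeroCount_le_xiDerivCriticalZeroCount_add_one`), Conrey's Lemma 2
(`N^{(1)} ≤ N + C log T`, `exists_abs_xiDerivZeroCount_sub_zetaZeroCount_le_log`) and
`N(T) ≥ ½(T/2π) log T` eventually. [cite: Conrey1983, §1 (p. 49) and Lemma 2 (p. 52)] -/
theorem eventually_mul_xiDerivZeroCount_le_of_simpleCritical {κ : ℝ}
    (h : ∀ ε : ℝ, 0 < ε → ∀ᶠ T : ℝ in atTop, (κ - ε) * (zetaZeroCount T : ℝ) ≤ simpleCriticalZeroCount T)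
    (ε : ℝ) (hε : 0 < ε) :
    ∀ᶠ T : ℝ in atTop, (κ - ε) * (xiDerivZeroCount 1 T : ℝ) ≤ xiDerivCriticalZeroCount 1 T := by
  rcases le_or_gt (κ - ε) 0 with hneg | hpos
  · exact Filter.Eventually.of_forall fun T ↦ by
      have h0 : (0 : ℝ) ≤ xiDerivCriticalZeroCount 1 T := Nat.cast_nonneg _
      have h1 : (0 : ℝ) ≤ xiDerivZeroCount 1 T := Nat.cast_nonneg _
      nlinarith
  obtain ⟨C, T₀, hT₀, hC⟩ := exists_abs_xiDerivZeroCount_sub_zetaZeroCount_le_log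
  have hA := h (ε / 4) (by positivity)
  have hmain := AlpogeFurman2026.eventually_zetaZeroCount_near_main (1 / 2) (by norm_num)
  have hNlim : Tendsto (fun T : ℝ ↦ (zetaZeroCount T : ℝ)) atTop atTop :=
    tendsto_natCast_atTop_atTop.comp tendsto_zetaZeroCount_atTop_holds
  filter_upwards [hA, hmain, eventually_ge_atTop T₀, eventually_gt_atTop (1 : ℝ),
    eventually_ge_atTop (16 * Real.pi * |C| * κ / ε), hNlim.eventually_ge_atTop (4 / ε)]
    with T hAT hN hT hT1 hTC hNε
  have hπ := Real.pi_pos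
  have hL : 0 < Real.log T := Real.log_pos hT1
  have hκ : 0 < κ := by linarith
  -- Rolle: `N₀ˢ ≤ N′₀ + 1`, and `1 ≤ (ε/4) N(T)`
  have hR : (simpleCriticalZeroCount T : ℝ) ≤ (xiDerivCriticalZeroCount 1 T : ℝ) + 1 := by
    exact_mod_cast simpleCriticalZeroCount_le_xiDerivCriticalZeroCount_add_one T
  have hone : 1 ≤ ε / 4 * (zetaZeroCount T : ℝ) := by
    have := (div_le_iff₀ hε).1 hNε
    linarith
  -- Conrey: `N₁ ≤ N + |C| log T`, and `κ |C| log T ≤ (ε/4) N(T)`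
  have hb := hC T hT
  have hN₁le : (xiDerivZeroCount 1 T : ℝ) ≤ zetaZeroCount T + |C| * Real.log T := by
    have := (abs_le.1 (hb.trans (mul_le_mul_of_nonneg_right (le_abs_self C) hL.le))).2
    linarith
  have hNlow : (1 - 1 / 2) * (T / (2 * Real.pi) * Real.log T) ≤ zetaZeroCount T := hN.1
  have hClog : κ * (|C| * Real.log T) ≤ ε / 4 * (zetaZeroCount T : ℝ) := by
    have h1 : κ * (|C| * Real.log T) ≤ ε / 4 * ((1 - 1 / 2) * (T / (2 * Real.pi) * Real.log T)) := by
      rw [div_le_iff₀ hε] at hTC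
      have : κ * |C| ≤ ε / 4 * ((1 - 1 / 2) * (T / (2 * Real.pi))) := by
        rw [show ε / 4 * ((1 - 1 / 2) * (T / (2 * Real.pi))) = ε * T / (16 * Real.pi) by ring,
          le_div_iff₀ (by positivity)]
        nlinarith
      nlinarith
    exact h1.trans (mul_le_mul_of_nonneg_left hNlow (by positivity))
  calc (κ - ε) * (xiDerivZeroCount 1 T : ℝ)
      ≤ (κ - ε) * (zetaZeroCount T + |C| * Real.log T) := mul_le_mul_of_nonneg_left hN₁le hpos.le
    _ ≤ (κ - ε) * zetaZeroCount T + κ * (|C| * Real.log T) := by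
        nlinarith [mul_nonneg (abs_nonneg C) hL.le]
    _ ≤ (κ - ε / 4) * zetaZeroCount T - 1 := by nlinarith
    _ ≤ simpleCriticalZeroCount T - 1 := by linarith
    _ ≤ xiDerivCriticalZeroCount 1 T := by linarith

/-- **Any cumulative proportion of simple critical zeros of `ζ` bounds `κ′₁` from below**: if for every
`ε > 0`, eventually `(κ − ε) N(T) ≤ N₀ˢ(T)`, then `κ ≤ κ′₁ = xiDerivCriticalLineProportion 1`.
[cite: Conrey1983, §1 (p. 49)] -/
theorem le_xiDerivCriticalLineProportion_one_of_simpleCritical {κ : ℝ}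
    (h : ∀ ε : ℝ, 0 < ε → ∀ᶠ T : ℝ in atTop,
      (κ - ε) * (zetaZeroCount T : ℝ) ≤ simpleCriticalZeroCount T) :
    κ ≤ xiDerivCriticalLineProportion 1 := by
  refine le_of_forall_pos_lt_add fun ε hε ↦ ?_
  have h' := le_xiDerivCriticalLineProportion_one_of_eventually_le
    (eventually_mul_xiDerivZeroCount_le_of_simpleCritical h (ε / 2) (by positivity))
  linarith

/-- **`κ′₁ ≥ 2 − c_MT⁻¹ = 0.67250…` unconditionally**: the proportion of zeros of `ξ′` on the critical
line is at least the Montgomery–Taylor simple-critical proportion of [AF26] Theorem A (via Rolle and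
Conrey's Lemma 2). [cite: AlpogeFurman2026, Theorem A (p. 1) and Remark 7.1] [cite: Conrey1983, §1 (p. 49)] -/
theorem two_sub_montgomeryTaylorInvConstant_le_xiDerivCriticalLineProportion_one :
    2 - montgomeryTaylorInvConstant ≤ xiDerivCriticalLineProportion 1 :=
  le_xiDerivCriticalLineProportion_one_of_simpleCritical AlpogeFurman2026_simple_critical_MT_cumulative

/-- Numerically: **`0.6725 ≤ κ′₁`** unconditionally (print: Conrey 1983 `0.8137`, named fact
`conrey1983_xiDeriv_one`, not proved in the tree). [cite: Conrey1983, Corollary (p. 50)]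
[cite: AlpogeFurman2026, Remark 7.1] -/
theorem xiDerivCriticalLineProportion_one_ge_06725 :
    (0.6725 : ℝ) ≤ xiDerivCriticalLineProportion 1 := by
  have hR := montgomeryTaylorInvConstant_bounds.2
  have h := two_sub_montgomeryTaylorInvConstant_le_xiDerivCriticalLineProportion_one
  linarith

end Literature.NumberTheory.LFunctions

end
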